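import Mathlib
import HarnessLib
import Summits.NavierStokesRegularity.NavierStokesRegularity.Theorems.PoloidalWindowDoorPoloidalWindowRigidityLeafUniformRidgeCore

/-!
# Route `PoloidalWindowDoor`, crux `PoloidalWindowRigidity` (stmt-NavierStokesRegularity-19708) — LINE 18 «leaf_uniform»
# (ns-idea-8 g9, v1.3.1): the CALCULUS CORE of the curtain law (R11 `CurtainInvariant` / R16 `LeafGlobalLaw` (b)), Mathlib only

Seat ns-es-p1 g7 (free prover hand keyed by director-ns g18, KEY-NS #190 (3): R8 → R16).  No Navier–Stokes content: this is the
pointwise identity behind the CURTAIN LAW of the line, in the same frame-free style as `…LeafUniformRidgeCore.ridge_core`, so that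
the assembly files (R16, and R11 if claimed) stay small.

Setting (as in `ridge_core`, now with all three partials): smooth `P₀, P₁, P₂ : ℝ³ → ℝ` with the Schwarz relations
`∂ᵢPⱼ = ∂ⱼPᵢ` (they are `∂ⱼw` of one function `w`), a smooth field `ω` with `ω₂ ≡ 0` and the «frozen law» `ω₀P₀ + ω₁P₁ ≡ 0`, and an
integral curve `γ` of `ω` on `(−ε, ε)` along which `P₀ = P₁ = P₂ = 0` (in R11/R16: `∇w = 0` on the hot set).

* `transport_hasDerivAt` — THE TRANSPORT IDENTITY: along the arc every second derivative `∂ₐPᵦ ∘ γ` has derivative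
  `−Σ_{j=0,1} (∂ₐωⱼ·∂ᵦPⱼ + ∂ᵦωⱼ·∂ₐPⱼ)` (differentiate the frozen law in the directions `a`, `e_b`, evaluate on the arc, and move the
  derivatives around with Schwarz);
* `kernel_relation` — `ω₀∂₀Pᵦ + ω₁∂₁Pᵦ = 0` on the arc (differentiate `Pᵦ ∘ γ ≡ 0`);
* `curtain_core` — with `L := ∂₀P₀ + ∂₁P₁ ≠ 0` and `ω ≠ 0` at `γ t`: the curtain quantity
  `∂₂P₂ − ((∂₀P₂)² + (∂₁P₂)²)/L` has derivative ZERO along the arc at `t`.  Algebra: from the kernel relations (`Hₕωₕ = 0`,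
  `u := ∇ₕP₂ ⊥ ωₕ`, `ωₕ ≠ 0`) one gets `Hₕu = L·u` and `|u|²Hₕ = L·u⊗u` (rank one), and then the transported derivatives cancel
  (`linear_combination`).  No implicit-function argument is needed.

HONEST LABEL: calculus lemmas; nothing about any crux, route item or Navier–Stokes regularity is proved here (all OPEN).
-/

noncomputable section

-- the summit and its single sub-problem share the name (CONVENTIONS §1), as in every Theorems file
set_option linter.dupNamespace false

namespace Summit.NavierStokesRegularity.NavierStokesRegularity.Theorems.PoloidalWindowDoorPoloidalWindowRigidityLeafUniformCurtainCore

open Set Function Filter Topology Metric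
open Summit.NavierStokesRegularity.NavierStokesRegularity.Theorems.PoloidalWindowDoorPoloidalWindowRigidityLeafUniformRidgeCore

section Generic

variable {E : Type*} [NormedAddCommGroup E] [NormedSpace ℝ E]

/-- MIXED second directional derivative of `φ₁ψ₁ + φ₂ψ₂` for `C²` real functions (Leibniz twice, directions `a` then `b`). [folklore] -/
theorem fderiv2_mixed_two_products_apply {φ₁ ψ₁ φ₂ ψ₂ : E → ℝ}
    (h₁ : ContDiff ℝ 2 φ₁) (g₁ : ContDiff ℝ 2 ψ₁) (h₂ : ContDiff ℝ 2 φ₂) (g₂ : ContDiff ℝ 2 ψ₂)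
    (a b x : E) :
    fderiv ℝ (fun y => fderiv ℝ (fun z => φ₁ z * ψ₁ z + φ₂ z * ψ₂ z) y a) x b =
      (fderiv ℝ (fun y => fderiv ℝ φ₁ y a) x b * ψ₁ x + fderiv ℝ φ₁ x a * fderiv ℝ ψ₁ x b +
          fderiv ℝ φ₁ x b * fderiv ℝ ψ₁ x a + φ₁ x * fderiv ℝ (fun y => fderiv ℝ ψ₁ y a) x b) +
        (fderiv ℝ (fun y => fderiv ℝ φ₂ y a) x b * ψ₂ x + fderiv ℝ φ₂ x a * fderiv ℝ ψ₂ x b +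
          fderiv ℝ φ₂ x b * fderiv ℝ ψ₂ x a + φ₂ x * fderiv ℝ (fun y => fderiv ℝ ψ₂ y a) x b) := by
  have two : (2 : WithTop ℕ∞) = 1 + 1 := by norm_num
  have d1 : ∀ {φ : E → ℝ}, ContDiff ℝ 2 φ → Differentiable ℝ φ := fun h => h.differentiable (by norm_num)
  have d2 : ∀ {φ : E → ℝ}, ContDiff ℝ 2 φ → Differentiable ℝ (fun y => fderiv ℝ φ y a) := fun h =>
    (contDiff_fderiv_apply_dir (n := 1) (by rw [two] at h; exact h) a).differentiable one_ne_zero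
  have hfirst : (fun y => fderiv ℝ (fun z => φ₁ z * ψ₁ z + φ₂ z * ψ₂ z) y a) = fun y =>
      (fun y => fderiv ℝ φ₁ y a) y * ψ₁ y + φ₁ y * (fun y => fderiv ℝ ψ₁ y a) y +
        ((fun y => fderiv ℝ φ₂ y a) y * ψ₂ y + φ₂ y * (fun y => fderiv ℝ ψ₂ y a) y) := by
    funext y
    exact fderiv_two_products_apply (d1 h₁ y) (d1 g₁ y) (d1 h₂ y) (d1 g₂ y) a
  rw [hfirst]
  have e1 := ((d2 h₁ x).hasFDerivAt.mul (d1 g₁ x).hasFDerivAt)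
  have e2 := ((d1 h₁ x).hasFDerivAt.mul (d2 g₁ x).hasFDerivAt)
  have e3 := ((d2 h₂ x).hasFDerivAt.mul (d1 g₂ x).hasFDerivAt)
  have e4 := ((d1 h₂ x).hasFDerivAt.mul (d2 g₂ x).hasFDerivAt)
  have etot := (e1.add e2).add (e3.add e4)
  rw [show (fun y => (fun y => fderiv ℝ φ₁ y a) y * ψ₁ y + φ₁ y * (fun y => fderiv ℝ ψ₁ y a) y +
        ((fun y => fderiv ℝ φ₂ y a) y * ψ₂ y + φ₂ y * (fun y => fderiv ℝ ψ₂ y a) y)) =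
      ((fun y => fderiv ℝ φ₁ y a) * ψ₁ + φ₁ * (fun y => fderiv ℝ ψ₁ y a)) +
        ((fun y => fderiv ℝ φ₂ y a) * ψ₂ + φ₂ * (fun y => fderiv ℝ ψ₂ y a)) from rfl]
  rw [etot.fderiv]
  simp only [add_apply, FunLike.coe_smul, Pi.smul_apply, smul_eq_mul]
  ring

end Generic

/-! ## The transport identity along an arc on which `∇w = 0` -/

section Transport

variable {P : Fin 3 → EuclideanSpace ℝ (Fin 3) → ℝ}
  {ω : EuclideanSpace ℝ (Fin 3) → EuclideanSpace ℝ (Fin 3)} {γ : ℝ → EuclideanSpace ℝ (Fin 3)} {ε : ℝ}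

/-- **Kernel relation.**  If `Pᵦ ∘ γ ≡ 0` on `(−ε, ε)` and `γ′ = ω ∘ γ` with `ω₂ ≡ 0`, then `ω₀∂₀Pᵦ + ω₁∂₁Pᵦ = 0` at `γ t`. [folklore] -/
theorem kernel_relation (hPs : ∀ (j : Fin 3) (n : ℕ), ContDiff ℝ n (P j)) (hω2 : ∀ x, ω x 2 = 0)
    (hzero : ∀ (j : Fin 3), ∀ s ∈ Ioo (-ε) ε, P j (γ s) = 0)
    (hγ : ∀ s ∈ Ioo (-ε) ε, HasDerivAt γ (ω (γ s)) s) (b : Fin 3) {t : ℝ} (ht : t ∈ Ioo (-ε) ε) :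
    ω (γ t) 0 * fderiv ℝ (P b) (γ t) (EuclideanSpace.single 0 1) +
      ω (γ t) 1 * fderiv ℝ (P b) (γ t) (EuclideanSpace.single 1 1) = 0 := by
  have hd : DifferentiableAt ℝ (P b) (γ t) := ((hPs b 1).differentiable one_ne_zero) _
  have h1 : HasDerivAt (fun s => P b (γ s)) (fderiv ℝ (P b) (γ t) (ω (γ t))) t :=
    hasDerivAt_comp_curve hd (hγ t ht)
  have h2 : HasDerivAt (fun s => P b (γ s)) 0 t := by
    refine (hasDerivAt_const t (0 : ℝ)).congr_of_eventuallyEq ?_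
    filter_upwards [Ioo_mem_nhds ht.1 ht.2] with s hs using hzero b s hs
  have h := h1.unique h2
  rwa [clm_apply_eq_sum_three, hω2, zero_mul, add_zero] at h

/-- **Transport identity.**  Under the Schwarz relations `∂ᵢPⱼ = ∂ⱼPᵢ`, the frozen law `ω₀P₀ + ω₁P₁ ≡ 0`, `ω₂ ≡ 0`, and
`P₀ = P₁ = P₂ = 0` along the integral curve `γ` of `ω` on `(−ε, ε)`: for every direction `a` and index `b`,
`(∂ₐPᵦ ∘ γ)′(t) = −Σ_{j=0,1} (∂ₐωⱼ·∂ᵦPⱼ + ∂ᵦωⱼ·∂ₐPⱼ)(γ t)` (`∂ᵦ := ∂_{e_b}`). [folklore] -/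
theorem transport_hasDerivAt (hPs : ∀ (j : Fin 3) (n : ℕ), ContDiff ℝ n (P j)) (hωs : ∀ n : ℕ, ContDiff ℝ n ω)
    (hSch : ∀ (i j : Fin 3) (x : EuclideanSpace ℝ (Fin 3)),
      fderiv ℝ (P j) x (EuclideanSpace.single i 1) = fderiv ℝ (P i) x (EuclideanSpace.single j 1))
    (hFro : ∀ x, ω x 0 * P 0 x + ω x 1 * P 1 x = 0) (hω2 : ∀ x, ω x 2 = 0)
    (hzero : ∀ (j : Fin 3), ∀ s ∈ Ioo (-ε) ε, P j (γ s) = 0)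
    (hγ : ∀ s ∈ Ioo (-ε) ε, HasDerivAt γ (ω (γ s)) s)
    (a : EuclideanSpace ℝ (Fin 3)) (b : Fin 3) {t : ℝ} (ht : t ∈ Ioo (-ε) ε) :
    HasDerivAt (fun s => fderiv ℝ (P b) (γ s) a)
      (-((fderiv ℝ (fun x => ω x 0) (γ t) a * fderiv ℝ (P 0) (γ t) (EuclideanSpace.single b 1) +
            fderiv ℝ (fun x => ω x 0) (γ t) (EuclideanSpace.single b 1) * fderiv ℝ (P 0) (γ t) a) +
          (fderiv ℝ (fun x => ω x 1) (γ t) a * fderiv ℝ (P 1) (γ t) (EuclideanSpace.single b 1) +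
            fderiv ℝ (fun x => ω x 1) (γ t) (EuclideanSpace.single b 1) * fderiv ℝ (P 1) (γ t) a))) t := by
  -- bookkeeping
  have hωc : ∀ (n : ℕ) (j : Fin 3), ContDiff ℝ n (fun x => ω x j) := fun n j => contDiff_euclidean.1 (hωs n) j
  have hD : ∀ (j : Fin 3) (c : EuclideanSpace ℝ (Fin 3)) (n : ℕ), ContDiff ℝ n (fun y => fderiv ℝ (P j) y c) :=
    fun j c n => contDiff_fderiv_apply_dir (n := n) (by exact_mod_cast hPs j (n + 1)) c
  have hC2 : ∀ (j : Fin 3) (x : EuclideanSpace ℝ (Fin 3)), ContDiffAt ℝ 2 (P j) x := fun j x => (hPs j 2).contDiffAt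
  -- chain rule and expansion along `ω (γ t)`
  have h := hasDerivAt_comp_curve (φ := fun x => fderiv ℝ (P b) x a)
    (((hD b a 1).differentiable one_ne_zero) _) (hγ t ht)
  rw [clm_apply_eq_sum_three, hω2, zero_mul, add_zero] at h
  -- move the derivatives: `∂ⱼ∂ₐP_b = ∂_b∂ₐPⱼ` at `γ t`, for `j = 0, 1`
  have hmove : ∀ j : Fin 3, fderiv ℝ (fun x => fderiv ℝ (P b) x a) (γ t) (EuclideanSpace.single j 1) =
      fderiv ℝ (fun x => fderiv ℝ (P j) x a) (γ t) (EuclideanSpace.single b 1) := by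
    intro j
    rw [fderiv_dir_comm (hC2 b _) a (EuclideanSpace.single j 1),
      show (fun x => fderiv ℝ (P b) x (EuclideanSpace.single j 1)) =
          fun x => fderiv ℝ (P j) x (EuclideanSpace.single b 1) from funext (hSch j b),
      fderiv_dir_comm (hC2 j _) (EuclideanSpace.single b 1) a]
  rw [hmove 0, hmove 1] at h
  -- the frozen law differentiated along `a` then `e_b`, evaluated on the arc
  have hFfun : (fun z => ω z 0 * P 0 z + ω z 1 * P 1 z) = fun _ => (0 : ℝ) := funext hFro
  have hE : fderiv ℝ (fun y => fderiv ℝ (fun z => ω z 0 * P 0 z + ω z 1 * P 1 z) y a) (γ t)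
      (EuclideanSpace.single b 1) = 0 := by
    rw [hFfun]; simp
  rw [fderiv2_mixed_two_products_apply (hωc 2 0) (hPs 0 2) (hωc 2 1) (hPs 1 2) a
    (EuclideanSpace.single b 1) (γ t), hzero 0 t ht, hzero 1 t ht] at hE
  refine h.congr_deriv ?_
  linear_combination hE

end Transport

/-! ## The curtain identity -/

/-- **Core of the curtain law (R11 / R16 (b)).**  In the setting of `transport_hasDerivAt`, at a parameter `t` where
`L := ∂₀P₀ + ∂₁P₁ ≠ 0` and `ω ≠ 0`, the curtain quantity `∂₂P₂ − ((∂₀P₂)² + (∂₁P₂)²)/L` evaluated along `γ` has derivative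
`0` at `t`.  Algebra: the kernel relations give `Hₕu = L·u` and `|u|²·Hₕ = L·u⊗u` for `u = (∂₀P₂, ∂₁P₂) ⊥ ωₕ ≠ 0`-kernel of the
symmetric `Hₕ = (∂ᵢPⱼ)_{i,j≤1}`; with the transported derivatives everything cancels. [folklore] -/
theorem curtain_core {P : Fin 3 → EuclideanSpace ℝ (Fin 3) → ℝ}
    {ω : EuclideanSpace ℝ (Fin 3) → EuclideanSpace ℝ (Fin 3)} {γ : ℝ → EuclideanSpace ℝ (Fin 3)} {ε t : ℝ}
    (hPs : ∀ (j : Fin 3) (n : ℕ), ContDiff ℝ n (P j)) (hωs : ∀ n : ℕ, ContDiff ℝ n ω)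
    (hSch : ∀ (i j : Fin 3) (x : EuclideanSpace ℝ (Fin 3)),
      fderiv ℝ (P j) x (EuclideanSpace.single i 1) = fderiv ℝ (P i) x (EuclideanSpace.single j 1))
    (hFro : ∀ x, ω x 0 * P 0 x + ω x 1 * P 1 x = 0) (hω2 : ∀ x, ω x 2 = 0)
    (hzero : ∀ (j : Fin 3), ∀ s ∈ Ioo (-ε) ε, P j (γ s) = 0)
    (hγ : ∀ s ∈ Ioo (-ε) ε, HasDerivAt γ (ω (γ s)) s) (ht : t ∈ Ioo (-ε) ε)
    (hL : fderiv ℝ (P 0) (γ t) (EuclideanSpace.single 0 1) + fderiv ℝ (P 1) (γ t) (EuclideanSpace.single 1 1) ≠ 0)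
    (hωne : ω (γ t) ≠ 0) :
    HasDerivAt (fun s => fderiv ℝ (P 2) (γ s) (EuclideanSpace.single 2 1) -
        (fderiv ℝ (P 2) (γ s) (EuclideanSpace.single 0 1) ^ 2 + fderiv ℝ (P 2) (γ s) (EuclideanSpace.single 1 1) ^ 2) /
          (fderiv ℝ (P 0) (γ s) (EuclideanSpace.single 0 1) + fderiv ℝ (P 1) (γ s) (EuclideanSpace.single 1 1))) 0 t := by
  -- the five transported derivatives and the three kernel relations
  have hT := fun (a : EuclideanSpace ℝ (Fin 3)) (b : Fin 3) =>
    transport_hasDerivAt hPs hωs hSch hFro hω2 hzero hγ a b ht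
  have hm := hT (EuclideanSpace.single 2 1) 2
  have hu0 := hT (EuclideanSpace.single 0 1) 2
  have hu1 := hT (EuclideanSpace.single 1 1) 2
  have hl0 := hT (EuclideanSpace.single 0 1) 0
  have hl1 := hT (EuclideanSpace.single 1 1) 1
  have hK0 := kernel_relation hPs hω2 hzero hγ 0 ht
  have hK1 := kernel_relation hPs hω2 hzero hγ 1 ht
  have hK2 := kernel_relation hPs hω2 hzero hγ 2 ht
  -- Schwarz at the point
  have s10 : fderiv ℝ (P 0) (γ t) (EuclideanSpace.single 1 1) = fderiv ℝ (P 1) (γ t) (EuclideanSpace.single 0 1) := hSch 1 0 (γ t)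
  have s20 : fderiv ℝ (P 0) (γ t) (EuclideanSpace.single 2 1) = fderiv ℝ (P 2) (γ t) (EuclideanSpace.single 0 1) := hSch 2 0 (γ t)
  have s21 : fderiv ℝ (P 1) (γ t) (EuclideanSpace.single 2 1) = fderiv ℝ (P 2) (γ t) (EuclideanSpace.single 1 1) := hSch 2 1 (γ t)
  rw [s10] at hK0
  -- `|ωₕ|² ≠ 0`
  have hg : (ω (γ t) 0 * ω (γ t) 0 + ω (γ t) 1 * ω (γ t) 1) ≠ 0 := by
    intro hzero'
    apply hωne
    have h2 : ‖ω (γ t)‖ ^ 2 = 0 := by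
      rw [EuclideanSpace.real_norm_sq_eq, Fin.sum_univ_three, hω2]
      linear_combination hzero'
    exact norm_eq_zero.1 (pow_eq_zero_iff two_ne_zero |>.1 h2)
  -- rank-one relations from the kernel relations (valid since `ωₕ ≠ 0`): `Hₕu = L u` and `|u|² Hₕ = L u⊗u`
  have hX : fderiv ℝ (P 0) (γ t) (EuclideanSpace.single 0 1) * fderiv ℝ (P 2) (γ t) (EuclideanSpace.single 0 1) + fderiv ℝ (P 1) (γ t) (EuclideanSpace.single 0 1) * fderiv ℝ (P 2) (γ t) (EuclideanSpace.single 1 1) - (fderiv ℝ (P 0) (γ t) (EuclideanSpace.single 0 1) + fderiv ℝ (P 1) (γ t) (EuclideanSpace.single 1 1)) * fderiv ℝ (P 2) (γ t) (EuclideanSpace.single 0 1) = 0 := by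
    have h : (ω (γ t) 0 * ω (γ t) 0 + ω (γ t) 1 * ω (γ t) 1) * (fderiv ℝ (P 0) (γ t) (EuclideanSpace.single 0 1) * fderiv ℝ (P 2) (γ t) (EuclideanSpace.single 0 1) + fderiv ℝ (P 1) (γ t) (EuclideanSpace.single 0 1) * fderiv ℝ (P 2) (γ t) (EuclideanSpace.single 1 1) - (fderiv ℝ (P 0) (γ t) (EuclideanSpace.single 0 1) + fderiv ℝ (P 1) (γ t) (EuclideanSpace.single 1 1)) * fderiv ℝ (P 2) (γ t) (EuclideanSpace.single 0 1)) = 0 := by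
      linear_combination (ω (γ t) 0 * fderiv ℝ (P 2) (γ t) (EuclideanSpace.single 1 1) - ω (γ t) 1 * fderiv ℝ (P 2) (γ t) (EuclideanSpace.single 0 1)) * hK1 + (ω (γ t) 1 * fderiv ℝ (P 1) (γ t) (EuclideanSpace.single 0 1) - ω (γ t) 0 * fderiv ℝ (P 1) (γ t) (EuclideanSpace.single 1 1)) * hK2
    exact (mul_eq_zero.1 h).resolve_left hg
  have hY : fderiv ℝ (P 1) (γ t) (EuclideanSpace.single 0 1) * fderiv ℝ (P 2) (γ t) (EuclideanSpace.single 0 1) + fderiv ℝ (P 1) (γ t) (EuclideanSpace.single 1 1) * fderiv ℝ (P 2) (γ t) (EuclideanSpace.single 1 1) - (fderiv ℝ (P 0) (γ t) (EuclideanSpace.single 0 1) + fderiv ℝ (P 1) (γ t) (EuclideanSpace.single 1 1)) * fderiv ℝ (P 2) (γ t) (EuclideanSpace.single 1 1) = 0 := by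
    have h : (ω (γ t) 0 * ω (γ t) 0 + ω (γ t) 1 * ω (γ t) 1) * (fderiv ℝ (P 1) (γ t) (EuclideanSpace.single 0 1) * fderiv ℝ (P 2) (γ t) (EuclideanSpace.single 0 1) + fderiv ℝ (P 1) (γ t) (EuclideanSpace.single 1 1) * fderiv ℝ (P 2) (γ t) (EuclideanSpace.single 1 1) - (fderiv ℝ (P 0) (γ t) (EuclideanSpace.single 0 1) + fderiv ℝ (P 1) (γ t) (EuclideanSpace.single 1 1)) * fderiv ℝ (P 2) (γ t) (EuclideanSpace.single 1 1)) = 0 := by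
      linear_combination (ω (γ t) 1 * fderiv ℝ (P 2) (γ t) (EuclideanSpace.single 0 1) - ω (γ t) 0 * fderiv ℝ (P 2) (γ t) (EuclideanSpace.single 1 1)) * hK0 + (ω (γ t) 0 * fderiv ℝ (P 1) (γ t) (EuclideanSpace.single 0 1) - ω (γ t) 1 * fderiv ℝ (P 0) (γ t) (EuclideanSpace.single 0 1)) * hK2
    exact (mul_eq_zero.1 h).resolve_left hg
  have hZ00 : (fderiv ℝ (P 2) (γ t) (EuclideanSpace.single 0 1) ^ 2 + fderiv ℝ (P 2) (γ t) (EuclideanSpace.single 1 1) ^ 2) * fderiv ℝ (P 0) (γ t) (EuclideanSpace.single 0 1) - (fderiv ℝ (P 0) (γ t) (EuclideanSpace.single 0 1) + fderiv ℝ (P 1) (γ t) (EuclideanSpace.single 1 1)) * fderiv ℝ (P 2) (γ t) (EuclideanSpace.single 0 1) ^ 2 = 0 := by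
    have h : (ω (γ t) 0 * ω (γ t) 0 + ω (γ t) 1 * ω (γ t) 1) * ((fderiv ℝ (P 2) (γ t) (EuclideanSpace.single 0 1) ^ 2 + fderiv ℝ (P 2) (γ t) (EuclideanSpace.single 1 1) ^ 2) * fderiv ℝ (P 0) (γ t) (EuclideanSpace.single 0 1) - (fderiv ℝ (P 0) (γ t) (EuclideanSpace.single 0 1) + fderiv ℝ (P 1) (γ t) (EuclideanSpace.single 1 1)) * fderiv ℝ (P 2) (γ t) (EuclideanSpace.single 0 1) ^ 2) = 0 := by
      linear_combination (fderiv ℝ (P 2) (γ t) (EuclideanSpace.single 0 1) ^ 2 + fderiv ℝ (P 2) (γ t) (EuclideanSpace.single 1 1) ^ 2) * (ω (γ t) 0 * hK0 - ω (γ t) 1 * hK1) - (fderiv ℝ (P 0) (γ t) (EuclideanSpace.single 0 1) + fderiv ℝ (P 1) (γ t) (EuclideanSpace.single 1 1)) * (ω (γ t) 0 * fderiv ℝ (P 2) (γ t) (EuclideanSpace.single 0 1) - ω (γ t) 1 * fderiv ℝ (P 2) (γ t) (EuclideanSpace.single 1 1)) * hK2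
    exact (mul_eq_zero.1 h).resolve_left hg
  have hZ01 : (fderiv ℝ (P 2) (γ t) (EuclideanSpace.single 0 1) ^ 2 + fderiv ℝ (P 2) (γ t) (EuclideanSpace.single 1 1) ^ 2) * fderiv ℝ (P 1) (γ t) (EuclideanSpace.single 0 1) - (fderiv ℝ (P 0) (γ t) (EuclideanSpace.single 0 1) + fderiv ℝ (P 1) (γ t) (EuclideanSpace.single 1 1)) * (fderiv ℝ (P 2) (γ t) (EuclideanSpace.single 0 1) * fderiv ℝ (P 2) (γ t) (EuclideanSpace.single 1 1)) = 0 := by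
    have h : (ω (γ t) 0 * ω (γ t) 0 + ω (γ t) 1 * ω (γ t) 1) * ((fderiv ℝ (P 2) (γ t) (EuclideanSpace.single 0 1) ^ 2 + fderiv ℝ (P 2) (γ t) (EuclideanSpace.single 1 1) ^ 2) * fderiv ℝ (P 1) (γ t) (EuclideanSpace.single 0 1) - (fderiv ℝ (P 0) (γ t) (EuclideanSpace.single 0 1) + fderiv ℝ (P 1) (γ t) (EuclideanSpace.single 1 1)) * (fderiv ℝ (P 2) (γ t) (EuclideanSpace.single 0 1) * fderiv ℝ (P 2) (γ t) (EuclideanSpace.single 1 1))) = 0 := by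
      linear_combination (fderiv ℝ (P 2) (γ t) (EuclideanSpace.single 0 1) ^ 2 + fderiv ℝ (P 2) (γ t) (EuclideanSpace.single 1 1) ^ 2) * (ω (γ t) 1 * hK0 + ω (γ t) 0 * hK1) - (fderiv ℝ (P 0) (γ t) (EuclideanSpace.single 0 1) + fderiv ℝ (P 1) (γ t) (EuclideanSpace.single 1 1)) * (ω (γ t) 1 * fderiv ℝ (P 2) (γ t) (EuclideanSpace.single 0 1) + ω (γ t) 0 * fderiv ℝ (P 2) (γ t) (EuclideanSpace.single 1 1)) * hK2
    exact (mul_eq_zero.1 h).resolve_left hg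
  -- the derivative of the curtain quantity vanishes
  have hq : HasDerivAt (fun s => fderiv ℝ (P 2) (γ s) (EuclideanSpace.single 0 1) * fderiv ℝ (P 2) (γ s) (EuclideanSpace.single 0 1) +
      fderiv ℝ (P 2) (γ s) (EuclideanSpace.single 1 1) * fderiv ℝ (P 2) (γ s) (EuclideanSpace.single 1 1)) _ t := (hu0.mul hu0).add (hu1.mul hu1)
  have hL' : HasDerivAt (fun s => fderiv ℝ (P 0) (γ s) (EuclideanSpace.single 0 1) + fderiv ℝ (P 1) (γ s) (EuclideanSpace.single 1 1)) _ t := hl0.add hl1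
  have hcurt := hm.sub (hq.div hL' hL)
  have hfun : (fun s => fderiv ℝ (P 2) (γ s) (EuclideanSpace.single 2 1) -
      (fderiv ℝ (P 2) (γ s) (EuclideanSpace.single 0 1) ^ 2 + fderiv ℝ (P 2) (γ s) (EuclideanSpace.single 1 1) ^ 2) /
        (fderiv ℝ (P 0) (γ s) (EuclideanSpace.single 0 1) + fderiv ℝ (P 1) (γ s) (EuclideanSpace.single 1 1))) =
      fun s => fderiv ℝ (P 2) (γ s) (EuclideanSpace.single 2 1) -
      (fderiv ℝ (P 2) (γ s) (EuclideanSpace.single 0 1) * fderiv ℝ (P 2) (γ s) (EuclideanSpace.single 0 1) +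
          fderiv ℝ (P 2) (γ s) (EuclideanSpace.single 1 1) * fderiv ℝ (P 2) (γ s) (EuclideanSpace.single 1 1)) /
        (fderiv ℝ (P 0) (γ s) (EuclideanSpace.single 0 1) + fderiv ℝ (P 1) (γ s) (EuclideanSpace.single 1 1)) := by
    funext s; ring
  rw [hfun]
  refine hcurt.congr_deriv ?_
  rw [s20, s21, s10, sub_eq_zero, eq_div_iff (pow_ne_zero 2 hL)]
  linear_combination (2 * (fderiv ℝ (P 0) (γ t) (EuclideanSpace.single 0 1) + fderiv ℝ (P 1) (γ t) (EuclideanSpace.single 1 1)) * fderiv ℝ (fun x => ω x 0) (γ t) (EuclideanSpace.single 2 1)) * hX + (2 * (fderiv ℝ (P 0) (γ t) (EuclideanSpace.single 0 1) + fderiv ℝ (P 1) (γ t) (EuclideanSpace.single 1 1)) * fderiv ℝ (fun x => ω x 1) (γ t) (EuclideanSpace.single 2 1)) * hY -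
    (2 * fderiv ℝ (fun x => ω x 0) (γ t) (EuclideanSpace.single 0 1)) * hZ00 - (2 * (fderiv ℝ (fun x => ω x 1) (γ t) (EuclideanSpace.single 0 1) + fderiv ℝ (fun x => ω x 0) (γ t) (EuclideanSpace.single 1 1))) * hZ01 + (2 * fderiv ℝ (fun x => ω x 1) (γ t) (EuclideanSpace.single 1 1)) * hZ00

end Summit.NavierStokesRegularity.NavierStokesRegularity.Theorems.PoloidalWindowDoorPoloidalWindowRigidityLeafUniformCurtainCore

end
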